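import Mathlib
import Summits.RiemannHypothesis.RiemannHypothesis.Theorems.JensenPolynomialsDefs
import Summits.RiemannHypothesis.RiemannHypothesis.Theses.JensenPolynomials
import Literature.NumberTheory.LFunctions.XiMoments

/-! # JensenHermiteSignTest — S-H1 (Hermite zero bound) and S-H2 (soundness of the Hermite sign test): the route item
`JensenPolynomials.HermiteSignTestSound`.  RH-FREE, ξ-free.  Verbatim port of HOME `rh-jensen-theory/JensenTargets.lean` v4.5 §7, §8.5 (cell rh-jensen,
HUMAN RULING D-0040; one file per source section, D-0064(4)).  Main theorems: `hermiteZeroBound_holds : HermiteZeroBound`,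
`hermiteSignTestSound_holds : HermiteSignTestSound`. -/

noncomputable section
set_option linter.dupNamespace false

open Polynomial Finset
open scoped Nat

namespace Summit.RiemannHypothesis.RiemannHypothesis.Theorems.JensenPolynomials

open Literature.NumberTheory.LFunctions

/-- **PROVED (the generic half of S-H2 / of S1)**: a nonzero real polynomial of degree `≤ d` whose values
alternate in sign along `d + 1` increasing abscissae splits over `ℝ` (tree: IVT `exists_roots_of_alternating`
+ root count `splits_of_roots`). -/
theorem splits_of_alternating_signs {P : ℝ[X]} {d : ℕ} (hP : P ≠ 0) (hdeg : P.natDegree ≤ d)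
    (u : Fin (d + 1) → ℝ) (hu : StrictMono u)
    (halt : ∀ i : Fin d, P.eval (u i.castSucc) * P.eval (u i.succ) < 0) : P.Splits := by
  obtain ⟨t, ht, -, hroot⟩ := exists_roots_of_alternating P u hu halt
  exact (splits_of_roots hP hdeg t ht.injective hroot).1

/-- Ratio induction behind S-H1: for `x > 0` with `x² ≥ 8k`, `H_{k+1}(x/2) ≥ (x/2)·H_k(x/2) > 0`
(three-term recurrence; elementary substitute for Sturm comparison). -/
theorem gorzHermite_eval_pos_aux (k : ℕ) {x : ℝ} (hx : 0 < x) (hk : 8 * (k : ℝ) ≤ x ^ 2) :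
    x / 2 * (gorzHermite k).eval x ≤ (gorzHermite (k + 1)).eval x ∧ 0 < (gorzHermite k).eval x := by
  induction k with
  | zero =>
    simp only [gorzHermite_zero, eval_one, mul_one, zero_add, gorzHermite_one, eval_X]
    exact ⟨by linarith, one_pos⟩
  | succ k ih =>
    have hk' : 8 * (k : ℝ) ≤ x ^ 2 := by push_cast at hk; linarith
    obtain ⟨h1, h0⟩ := ih hk'
    have hpos : 0 < (gorzHermite (k + 1)).eval x := lt_of_lt_of_le (by positivity) h1
    refine ⟨?_, hpos⟩
    rw [show k + 1 + 1 = k + 2 from rfl, gorzHermite_add_two, eval_sub, eval_mul, eval_X, eval_mul, eval_C]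
    -- need: 2(k+1)·H_k ≤ (x/2)·H_{k+1}; from x·H_k ≤ 2H_{k+1} and 8(k+1) ≤ x²
    have h2 : x * (gorzHermite k).eval x ≤ 2 * (gorzHermite (k + 1)).eval x := by linarith
    have h3 : 4 * ((k : ℝ) + 1) * (x * (gorzHermite k).eval x) ≤ x ^ 2 * (gorzHermite (k + 1)).eval x := by
      have := mul_le_mul_of_nonneg_left h2 (by positivity : (0 : ℝ) ≤ 4 * ((k : ℝ) + 1))
      push_cast at hk
      nlinarith [hpos.le]
    have h4 : 4 * ((k : ℝ) + 1) * (gorzHermite k).eval x ≤ x * (gorzHermite (k + 1)).eval x := by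
      have h3' : x * (4 * ((k : ℝ) + 1) * (gorzHermite k).eval x) ≤ x * (x * (gorzHermite (k + 1)).eval x) := by
        nlinarith [h3]
      exact le_of_mul_le_mul_left h3' hx
    nlinarith [h4]

/-- Parity: `H_k(−x/2) = (−1)^k H_k(x/2)`. -/
theorem gorzHermite_eval_neg (k : ℕ) (x : ℝ) :
    (gorzHermite k).eval (-x) = (-1) ^ k * (gorzHermite k).eval x := by
  induction k using Nat.strong_induction_on with
  | _ k ih =>
    rcases k with _ | _ | k
    · simp
    · simp
    · rw [show k + 1 + 1 = k + 2 from rfl, gorzHermite_add_two]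
      simp only [eval_sub, eval_mul, eval_X, eval_C]
      rw [ih (k + 1) (by omega), ih k (by omega), pow_succ, pow_succ]
      ring

/-- **PROVED: S-H1** — every zero of `H_d(X/2)` lies in `(−2√(2d+1), 2√(2d+1))` (indeed in
`|x| < √(8d)`). -/
theorem hermiteZeroBound_holds : HermiteZeroBound := by
  intro d x hx
  by_contra hlt
  rw [not_lt] at hlt
  have hs : (0 : ℝ) ≤ Real.sqrt (2 * d + 1) := Real.sqrt_nonneg _
  have hsq : Real.sqrt (2 * (d : ℝ) + 1) ^ 2 = 2 * d + 1 := Real.sq_sqrt (by positivity)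
  have hs1 : 1 ≤ Real.sqrt (2 * (d : ℝ) + 1) := by nlinarith [hsq]
  have habs : 0 < |x| := lt_of_lt_of_le (by positivity) hlt
  have hk : 8 * (d : ℝ) ≤ |x| ^ 2 := by nlinarith [hlt, hsq]
  have hpos := (gorzHermite_eval_pos_aux d habs hk).2
  rcases le_or_gt 0 x with h | h
  · rw [abs_of_nonneg h] at hpos
    exact hpos.ne' hx
  · rw [abs_of_neg h, gorzHermite_eval_neg, hx, mul_zero] at hpos
    exact lt_irrefl _ hpos

/-- Sign bookkeeping: consecutive alternating signs give a negative product. -/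
theorem mul_neg_of_alternate {a : ℕ} {p q : ℝ} (hp : 0 < (-1) ^ a * p) (hq : 0 < (-1) ^ (a + 1) * q) :
    p * q < 0 := by
  rw [pow_succ] at hq
  rcases neg_one_pow_eq_or ℝ a with h | h
  · rw [h] at hp hq
    nlinarith
  · rw [h] at hp hq
    nlinarith

/-- **PROVED: S-H2** — the Hermite sign test is SOUND: for `d ≥ 3` and a non-degenerate inner scale it
certifies that `J^{d,n}_γ` is hyperbolic (for ANY real sequence `γ`). Ingredients: the zeros of
`H_{d−1}(X/2)` are `d − 1` simple reals along which `H_{d−2}(X/2)` alternates (`gorzHermite_interlaces`),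
hence so does `H_d(X/2) = X·H_{d−1} − 2(d−1)H_{d−2}`, hence so does `J̃` by the test; S-H1 puts `±B_d`
outside; `d + 1` alternations ⇒ `d` real zeros (`splits_of_alternating_signs`); affine passage. -/
theorem hermiteSignTestSound_holds : HermiteSignTestSound := by
  intro γ d n hd _hA hB htest
  obtain ⟨m, rfl⟩ : ∃ m, d = m + 2 := ⟨d - 2, by omega⟩
  obtain ⟨hcrit, hplus, hminus⟩ := htest
  simp only [show m + 2 - 1 = m + 1 from by omega] at hcrit
  set P := gorttwNormalised γ (m + 2) n with hPdef
  set B := hermiteTestBound (m + 2) with hBdef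
  obtain ⟨r, hr, hQ, hsign⟩ := gorzHermite_interlaces m
  -- roots and signs at the critical points
  have hroot : ∀ i : Fin (m + 1), (gorzHermite (m + 1)).eval (r i) = 0 := by
    intro i
    rw [hQ, eval_prod]
    exact Finset.prod_eq_zero (Finset.mem_univ i) (by simp)
  have hS : ∀ i : Fin (m + 1), 0 < (-1) ^ (m + 1 + (i : ℕ)) * P.eval (r i) := by
    intro i
    have h1 := hsign i
    have h2 := hcrit (r i) (hroot i)
    have hG : (gorzHermite (m + 2)).eval (r i) = -(2 * ((m : ℝ) + 1)) * (gorzHermite m).eval (r i) := by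
      rw [gorzHermite_add_two]
      simp only [eval_sub, eval_mul, eval_X, eval_C, hroot i]
      ring
    rw [hG] at h2
    rw [show m + 1 + 1 + (i : ℕ) = (m + 1 + (i : ℕ)) + 1 from by ring, pow_succ] at h1
    rcases neg_one_pow_eq_or ℝ (m + 1 + (i : ℕ)) with h | h
    · rw [h] at h1 ⊢
      have hm : (gorzHermite m).eval (r i) < 0 := by linarith
      have : 0 < -(2 * ((m : ℝ) + 1)) * (gorzHermite m).eval (r i) := by nlinarith
      nlinarith
    · rw [h] at h1 ⊢
      have hm : 0 < (gorzHermite m).eval (r i) := by linarith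
      have : -(2 * ((m : ℝ) + 1)) * (gorzHermite m).eval (r i) < 0 := by nlinarith
      nlinarith
  -- the critical points lie inside (−B, B)
  have hBbig : 2 * Real.sqrt (2 * ((m : ℝ) + 1) + 1) < B := by
    have : Real.sqrt (2 * ((m : ℝ) + 1) + 1) ≤ Real.sqrt (2 * ((m : ℝ) + 2) + 1) :=
      Real.sqrt_le_sqrt (by linarith)
    rw [hBdef, hermiteTestBound]
    push_cast
    linarith
  have hin : ∀ i : Fin (m + 1), -B < r i ∧ r i < B := by
    intro i
    have h := hermiteZeroBound_holds (m + 1) (r i) (hroot i)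
    push_cast at h
    constructor
    · linarith [neg_abs_le (r i)]
    · linarith [le_abs_self (r i)]
  -- the d + 1 = m + 3 test abscissae
  let w : Fin (m + 2) → ℝ := Fin.cons (-B) r
  let u : Fin (m + 3) → ℝ := Fin.snoc w B
  have hw0 : w 0 = -B := rfl
  have hws : ∀ j : Fin (m + 1), w j.succ = r j := fun j => by simp [w]
  have huc : ∀ i : Fin (m + 2), u i.castSucc = w i := fun i => by simp [u]
  have hul : u (Fin.last (m + 2)) = B := by simp [u]
  -- sign of P at −B in alternating form, and at the last critical point
  have hm0 : 0 < (-1) ^ m * P.eval (-B) := by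
    rw [pow_add, neg_one_sq, mul_one] at hminus
    exact hminus
  have hlast : P.eval (r (Fin.last m)) < 0 := by
    have h := hS (Fin.last m)
    rw [Fin.val_last, show m + 1 + m = 2 * m + 1 from by ring, pow_succ, pow_mul, neg_one_sq, one_pow,
      one_mul] at h
    linarith
  have hstep : ∀ i : Fin (m + 2), u i.castSucc < u i.succ ∧ P.eval (u i.castSucc) * P.eval (u i.succ) < 0 := by
    intro i
    rw [huc i]
    rcases Fin.eq_castSucc_or_eq_last i with ⟨k, rfl⟩ | rfl
    · -- i = k.castSucc, k : Fin (m+1): next point is r k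
      rw [Fin.succ_castSucc, huc, hws]
      rcases Fin.eq_zero_or_eq_succ k with rfl | ⟨j, rfl⟩
      · rw [Fin.castSucc_zero, hw0]
        refine ⟨(hin 0).1, mul_neg_of_alternate hm0 ?_⟩
        simpa using hS 0
      · rw [← Fin.succ_castSucc, hws]
        refine ⟨hr (Fin.castSucc_lt_succ (i := j)), mul_neg_of_alternate (hS j.castSucc) ?_⟩
        have := hS j.succ
        simpa [Fin.val_succ, add_assoc] using this
    · -- i = last: the pair (r last, B)
      rw [Fin.succ_last, hul, ← Fin.succ_last, hws]
      exact ⟨(hin _).2, mul_neg_of_neg_of_pos hlast hplus⟩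
  have hu : StrictMono u := by
    rw [Fin.strictMono_iff_lt_succ]
    exact fun i => (hstep i).1
  have halt : ∀ i : Fin (m + 2), P.eval (u i.castSucc) * P.eval (u i.succ) < 0 := fun i => (hstep i).2
  -- P ≠ 0, deg P ≤ m + 2, so P splits; then undo the affine substitution
  have hPne : P ≠ 0 := by
    intro h
    rw [h, eval_zero] at hplus
    exact lt_irrefl _ hplus
  have hg : (C (gorttwR γ (n + (m + 2)) * gorttwDelta γ (n + (m + 2))) * X +
      C (-gorttwR γ (n + (m + 2)))).natDegree = 1 := by
    rw [natDegree_add_C, natDegree_C_mul_X _ hB]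
  have hdeg : P.natDegree ≤ m + 2 := by
    rw [hPdef, gorttwNormalised]
    refine (natDegree_C_mul_le _ _).trans ?_
    refine natDegree_comp_le.trans ?_
    rw [hg, mul_one]
    exact natDegree_jensenPoly_le γ (m + 2) n
  have hPs : P.Splits := splits_of_alternating_signs hPne hdeg u hu halt
  rw [splits_iff_comp_splits_of_natDegree_eq_one hg]
  have hdvd : (jensenPoly γ (m + 2) n).comp (C (gorttwR γ (n + (m + 2)) * gorttwDelta γ (n + (m + 2))) * X +
      C (-gorttwR γ (n + (m + 2)))) ∣ P := by
    rw [hPdef, gorttwNormalised]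
    exact dvd_mul_left _ _
  exact Splits.of_dvd hPs hPne hdvd

/-- The gate's `_holds` naming convention for the closed Prop `HermiteSignTestSound` (clears the route's
staffability debt `no_holds` on `…Theorems.JensenPolynomials.HermiteSignTestSound`; same proof). -/
theorem HermiteSignTestSound_holds : HermiteSignTestSound := hermiteSignTestSound_holds

/-! ## ITEM CLOSER (route `JensenPolynomials`; the Theses decl is this statement by definition). -/

/-- **Item closer** (route `JensenPolynomials`, item `HermiteSignTestSound` = S-H2): the Theses decl
unfolds to `HermiteSignTestSound`, proved above as `hermiteSignTestSound_holds` (RH-FREE, ξ-free). -/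
theorem hermiteSignTestSound_item :
    Summit.RiemannHypothesis.RiemannHypothesis.Theses.JensenPolynomials.HermiteSignTestSound :=
  HermiteSignTestSound_holds

end Summit.RiemannHypothesis.RiemannHypothesis.Theorems.JensenPolynomials

end
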